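import Mathlib
import HarnessLib
import Summits.NavierStokesRegularity.NavierStokesRegularity.Theorems.PoloidalWindowDoorPoloidalWindowRigidityForwardSmallness
import Literature.Analysis.FluidPDE.TypeIAncientMild

/-!
# TypeILiouvilleTypeIDoorAbsoluteFloor — crux (L) stmt-NavierStokesRegularity-10661 `TypeIliouvilleL`, registered stub
# `stub_typeIAncientLiouville_knssGauge` (door stmt-4050): AN ABSOLUTE FAR-PAST FLOOR FOR NON-TRIVIAL TYPE-I PROFILES

Helper for stmt-NavierStokesRegularity-10661 (`--supports`); theorems only, no definitions, no named-fact hypotheses;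
closes no item; Navier–Stokes regularity is NOT proved here (leafhand seat of the EulerZoomLiouville route).

The tree's `PoloidalWindowDoorPoloidalWindowRigidityForwardSmallness.eq_zero_of_frequently_small` kills a Type-I Oseen
profile that is small at some slice below every `T` FOR EVERY `ε > 0` (`liminf_{t→−∞} √(−t)‖v(t)‖_∞ = 0`), and
`exists_uniformly_nonsmall` gives a profile-dependent floor.  Its proof uses one `ε` only — `min(ε₀/2, κ)` from the
backward ε-regularity `exists_eps_eq_zero_tail` and the forward smallness `exists_kappa_forward_small`, both ABSOLUTE —
so the floor is in fact UNIVERSAL: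

* `exists_abs_eps_eq_zero_of_frequently_small` — there is an absolute `ε₁ > 0` such that every field with the Type-I
  rate and the Oseen identity which has, below every `T`, ONE slice with `√(−t)‖v(t,x)‖ ≤ ε₁` for all `x`, vanishes
  (`liminf_{t→−∞} √(−t)‖v(t)‖_∞ < ε₁` suffices — smallness at a SEQUENCE of times, not on a tail).
* `exists_abs_eps_typeI_eq_zero_of_frequently_small` — the same on `IsTypeIAncientMild C u`;
  `knssGauge_eq_zero_of_frequently_small_abs` — by the registered stub's verbatim binders.
* `exists_abs_floor_of_typeI_ne_zero` / `exists_abs_floor_eventually_of_typeI_ne_zero` — **ABSOLUTE FAR-PAST FLOOR**: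
  one `ε₁ > 0` such that EVERY non-trivial Type-I ancient mild field (any Type-I constant `C`) has, for all `t` below
  some `T < 0`, a point with `√(−t)‖u(t,x)‖ > ε₁`.  Reading on door 4050: a counterexample's scale-invariant size is
  bounded below by a universal constant on every far-past slice; compare the tree's tail version
  `exists_typeIAncientMild_eq_zero_of_small_on_end` (smallness on a whole half-line) and the `∀ ε` version.

HONEST LABEL: repackaging of the tree's forward-smallness / backward-ε-regularity pair with the constant made explicit;
nothing here proves a registered stub, (L), or NS regularity; rung 0.
[cite: KochNadirashviliSereginSverak2009, §4 (i) p. 8, (1.4) (arXiv:0709.3599)] [cite: ChaeWolf2017RemovingDSS, §3 Step 1 (arXiv:1610.09464 p. 8)]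
-/

noncomputable section
open MeasureTheory Filter Set Function Metric
open scoped Topology ENNReal NNReal
open Literature.Analysis Literature.Analysis.FluidPDE Literature.Analysis.UnboundedOperators
open Summit.NavierStokesRegularity.NavierStokesRegularity.Theorems.PoloidalWindowDoorPoloidalWindowRigidityZoomOut
open Summit.NavierStokesRegularity.NavierStokesRegularity.Theorems.PoloidalWindowDoorPoloidalWindowRigidityForwardSmallness
set_option linter.dupNamespace false
namespace Summit.NavierStokesRegularity.NavierStokesRegularity.Theorems.TypeILiouvilleTypeIDoorAbsoluteFloor

/-- **ABSOLUTE ε: FREQUENTLY SMALL ⟹ TRIVIAL.**  There is an absolute `ε₁ > 0` such that every field `v` with the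
Type-I rate `‖v(t,x)‖ ≤ C/√(−t)` (any `C`) and the Oseen identity between negative times which has, below every `T`, a
slice `t < T` with `√(−t)‖v(t,x)‖ ≤ ε₁` for all `x`, vanishes identically on `t < 0`: forward smallness
(`exists_kappa_forward_small`, `ε₁ ≤ κ`) spreads `√(−τ)‖v(τ,·)‖ ≤ 2ε₁ ≤ ε₀` from each small slice to `(t, 0)`, hence to
all of `(−∞,0)`, and the backward ε-regularity `exists_eps_eq_zero_tail` ends.
[cite: KochNadirashviliSereginSverak2009, §4 (i) (arXiv:0709.3599)] [cite: ChaeWolf2017RemovingDSS, §3 Step 1] -/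
theorem exists_abs_eps_eq_zero_of_frequently_small :
    ∃ ε : ℝ, 0 < ε ∧ ∀ {C : ℝ} {v : ℝ → EuclideanSpace ℝ (Fin 3) → EuclideanSpace ℝ (Fin 3)},
      HasTypeITimeDecay C v →
      (∀ s t : ℝ, s < t → t < 0 → ∀ x,
        v t x = UnboundedOperators.heatExtension (v s) (t - s) x - oseenDuhamel 1 s v v t x) →
      (∀ T : ℝ, ∃ t < T, ∀ x, Real.sqrt (-t) * ‖v t x‖ ≤ ε) → ∀ t < 0, ∀ x, v t x = 0 := by
  obtain ⟨ε₀, hε₀, H⟩ := exists_eps_eq_zero_tail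
  obtain ⟨κ, hκ, F⟩ := exists_kappa_forward_small
  set ε : ℝ := min (ε₀ / 2) κ with hε
  have hε0 : 0 < ε := lt_min (by positivity) hκ
  have hεκ : ε ≤ κ := min_le_right _ _
  have hεε₀ : 2 * ε ≤ ε₀ := by have := min_le_left (ε₀ / 2) κ; linarith
  refine ⟨ε, hε0, fun {C} {v} hrate hmild hfreq => ?_⟩
  refine H le_rfl hmild fun τ hτ x => ?_
  obtain ⟨t, htτ, ht⟩ := hfreq τ
  have ht0 : t < 0 := htτ.trans hτ
  have hst : 0 < Real.sqrt (-t) := Real.sqrt_pos.2 (neg_pos.2 ht0)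
  have hsτ : 0 < Real.sqrt (-τ) := Real.sqrt_pos.2 (neg_pos.2 hτ)
  set δ : ℝ := ε / Real.sqrt (-t) with hδ
  have hδ0 : 0 < δ := div_pos hε0 hst
  have hsmall : ∀ y, ‖v t y‖ ≤ δ := fun y => by
    rw [hδ, le_div_iff₀ hst, mul_comm]; exact ht y
  have hκ' : Real.sqrt (-t) * δ ≤ κ := by
    rw [hδ, mul_div_cancel₀ _ hst.ne']; exact hεκ
  have h2 := F hrate hmild ht0 hδ0 hsmall hκ' τ ⟨htτ, hτ⟩ x
  have hsq : Real.sqrt (-τ) ≤ Real.sqrt (-t) := Real.sqrt_le_sqrt (by linarith)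
  calc Real.sqrt (-τ) * ‖v τ x‖ ≤ Real.sqrt (-τ) * (2 * δ) := mul_le_mul_of_nonneg_left h2 hsτ.le
    _ ≤ Real.sqrt (-t) * (2 * δ) := mul_le_mul_of_nonneg_right hsq (by positivity)
    _ = 2 * ε := by rw [hδ]; field_simp
    _ ≤ ε₀ := hεε₀

/-- The same on the packaged Type-I ancient mild class: an absolute `ε₁ > 0` such that every `IsTypeIAncientMild C u`
(any `C`) with a slice `√(−t)‖u(t,·)‖ ≤ ε₁` below every `T` vanishes.
[cite: KochNadirashviliSereginSverak2009, §4 (i) (arXiv:0709.3599)] -/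
theorem exists_abs_eps_typeI_eq_zero_of_frequently_small :
    ∃ ε : ℝ, 0 < ε ∧ ∀ {C : ℝ} {u : ℝ → EuclideanSpace ℝ (Fin 3) → EuclideanSpace ℝ (Fin 3)},
      IsTypeIAncientMild C u →
      (∀ T : ℝ, ∃ t < T, ∀ x, Real.sqrt (-t) * ‖u t x‖ ≤ ε) → ∀ t < 0, ∀ x, u t x = 0 := by
  obtain ⟨ε, hε, h⟩ := exists_abs_eps_eq_zero_of_frequently_small
  exact ⟨ε, hε, fun {C} {u} hu hfreq => h hu.hasTypeITimeDecay (fun s t hst ht x => hu.mild_eq_heatExtension hst ht x)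
    hfreq⟩

/-- **ABSOLUTE FAR-PAST FLOOR OF NON-TRIVIAL TYPE-I PROFILES.**  There is an absolute `ε₁ > 0` such that every Type-I
ancient mild field `u` (any Type-I constant) which does not vanish identically admits `T < 0` with: every slice `t < T`
carries a point `x` with `ε₁ < √(−t)‖u(t,x)‖`. [cite: KochNadirashviliSereginSverak2009, §4 (i), (1.4) (arXiv:0709.3599)] -/
theorem exists_abs_floor_of_typeI_ne_zero :
    ∃ ε : ℝ, 0 < ε ∧ ∀ {C : ℝ} {u : ℝ → EuclideanSpace ℝ (Fin 3) → EuclideanSpace ℝ (Fin 3)},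
      IsTypeIAncientMild C u → (∃ t < 0, ∃ x, u t x ≠ 0) →
      ∃ T : ℝ, T < 0 ∧ ∀ t < T, ∃ x, ε < Real.sqrt (-t) * ‖u t x‖ := by
  obtain ⟨ε, hε, h⟩ := exists_abs_eps_typeI_eq_zero_of_frequently_small
  refine ⟨ε, hε, fun {C} {u} hu hne => ?_⟩
  by_contra hcon
  push Not at hcon
  obtain ⟨t, ht, x, hx⟩ := hne
  refine hx (h hu (fun T => ?_) t ht x)
  obtain ⟨t', ht', h'⟩ := hcon (min T (-1)) (lt_of_le_of_lt (min_le_right _ _) (by norm_num))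
  exact ⟨t', lt_of_lt_of_le ht' (min_le_left _ _), h'⟩

/-- Filter form of the absolute floor: for the absolute `ε₁`, every non-trivial Type-I ancient mild field has
`∀ᶠ t → −∞, ∃ x, ε₁ < √(−t)‖u(t,x)‖`. [cite: KochNadirashviliSereginSverak2009, §4 (i) (arXiv:0709.3599)] -/
theorem exists_abs_floor_eventually_of_typeI_ne_zero :
    ∃ ε : ℝ, 0 < ε ∧ ∀ {C : ℝ} {u : ℝ → EuclideanSpace ℝ (Fin 3) → EuclideanSpace ℝ (Fin 3)},
      IsTypeIAncientMild C u → (∃ t < 0, ∃ x, u t x ≠ 0) →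
      ∀ᶠ t in atBot, ∃ x, ε < Real.sqrt (-t) * ‖u t x‖ := by
  obtain ⟨ε, hε, h⟩ := exists_abs_floor_of_typeI_ne_zero
  refine ⟨ε, hε, fun {C} {u} hu hne => ?_⟩
  obtain ⟨T, -, hT⟩ := h hu hne
  filter_upwards [eventually_lt_atBot T] with t ht
  exact hT t ht

/-- **By the registered stub's verbatim binders.**  There is an absolute `ε₁ > 0` such that the stub
`stub_typeIAncientLiouville_knssGauge` HOLDS for every `u` satisfying its literal KNSS-gauge hypotheses AND having a
slice with `√(−t)‖u(t,·)‖ ≤ ε₁` below every `T`: the residual of door 4050 consists of profiles whose scale-invariant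
size stays above `ε₁` on EVERY far-past slice. [cite: KochNadirashviliSereginSverak2009, §4 p. 8, (1.4) (arXiv:0709.3599)] -/
theorem knssGauge_eq_zero_of_frequently_small_abs :
    ∃ ε : ℝ, 0 < ε ∧ ∀ (C : ℝ) (u : ℝ → EuclideanSpace ℝ (Fin 3) → EuclideanSpace ℝ (Fin 3)),
      (ContDiffOn ℝ (⊤ : ℕ∞) (Function.uncurry u) (Set.Iio 0 ×ˢ Set.univ) ∧
        (∀ t < 0, Literature.Analysis.FluidPDE.VectorCalculus.IsDivFree (u t)) ∧
        (∀ s t : ℝ, s < t → t < 0 → ∀ x, u t x = Literature.Analysis.FluidPDE.heatFlow (u s) (t - s) x -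
          ∫ τ in Set.Ioo s t, ∫ y, Literature.Analysis.FluidPDE.oseenKernel (t - τ) (x - y) (u τ y) (u τ y)) ∧
        Literature.Analysis.FluidPDE.HasTypeITimeDecay C u) →
      (∀ T : ℝ, ∃ t < T, ∀ x, Real.sqrt (-t) * ‖u t x‖ ≤ ε) → ∀ t < 0, ∀ x, u t x = 0 := by
  obtain ⟨ε, hε, h⟩ := exists_abs_eps_typeI_eq_zero_of_frequently_small
  exact ⟨ε, hε, fun C u hu hfreq => h (isTypeIAncientMild_iff.2 hu) hfreq⟩

end Summit.NavierStokesRegularity.NavierStokesRegularity.Theorems.TypeILiouvilleTypeIDoorAbsoluteFloor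

end
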